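import Summits.ResolutionOfSingularities.ResolutionOfSingularities.Theorems.DescentDescentPerfectToAllSeparableOverFg
import Mathlib.FieldTheory.KummerPolynomial
import Mathlib.FieldTheory.Separable
import Mathlib.RingTheory.PowerBasis
import Mathlib.RingTheory.Adjoin.Polynomial.Basic

/-!
# `DescentPerfectToAll` (stmt-ResolutionOfSingularities-0549) holds for ground fields algebraic over
# `𝔽_p(t)` with `t` not a `p`-th power — the transcendence-degree-one layer of the crux

Route `ResolutionOfSingularities/Descent`, crux `DescentPerfectToAll`. Helper (OURS; not a statement of any
manuscript). `DescentDescentPerfectToAllSeparableOverFg.lean` proves the crux's conclusion for every ground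
field separable algebraic over a finitely generated subfield. This file proves the field-theoretic fact that
feeds it for the next layer of ground fields: if `t ∈ k` is NOT a `p`-th power in `k` and `k` is algebraic
over `𝔽_p(t) = closure {t}`, then `k` is SEPARABLE over `𝔽_p(t)`:

* `sum_pow_mul_pow_eq_zero` — `1, t, …, t^{p-1}` are linearly independent over `k^p`
  (`X^p - t^p` is irreducible over `k^p` since `t ∉ k^p`).
* `exists_digits_of_mem_closure_singleton` — every `c ∈ 𝔽_p(t)` is `∑_{j<p} t^j d_j^p` with `d_j ∈ 𝔽_p(t)`
  (digit expansion of polynomials in `t` by residues of exponents mod `p`; `𝔽_p` is perfect).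
* `linearIndepOn_pow_closure_singleton` — hence MacLane's criterion holds for `k / 𝔽_p(t)`:
  `𝔽_p(t)`-linearly independent finite families in `k` have independent `p`-th powers.
* `isSeparable_closure_singleton_of_isAlgebraic` — so if `k / 𝔽_p(t)` is algebraic it is separable (an
  inseparable `a` would have `minpoly = g(X^p)`, making `1, a^p, …, a^{p·deg g}` dependent although
  `1, a, …, a^{deg g}` are independent).
* `hasResolution_of_perfectRes_of_isAlgebraic_closure_singleton` / `descentPerfectToAll_trdegOne` — **the
  crux's conclusion for every ground field `k` algebraic over `𝔽_p(t)` for some `t ∈ k ∖ k^p`**, i.e. for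
  every NON-PERFECT ground field of transcendence degree `1` over `𝔽_p` (perfect ground fields are the
  hypothesis itself: `descentPerfectToAll_trdegLEOne`). All dimensions of `X`.

What this layer does NOT settle (docstring revised 2026-08-26 after a wrong example was posted): the residual of
stmt-0549 consists of the ground fields `k` that are separable over NO subfield essentially of finite type over a
perfect subfield of `k` — the tree also proves the essentially-finite-type-over-perfect case,
`Theorems.hasResolution_of_perfectRes_of_essFiniteType`, which covers e.g. `𝔽_p(t)(u^{1/p^∞}) = 𝔽_p(u^{1/p^∞})(t)`.
Since every perfect subfield lies in `k^{p^∞} = ⋂ₙ k^{pⁿ}`, the standing witness for the residual is `𝔽_p((t))`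
(`k^{p^∞} = 𝔽_p`, `p`-degree `1`, infinite transcendence degree).
-/

noncomputable section

set_option linter.dupNamespace false -- mandated namespace of this single-conjunct summit

open CategoryTheory CategoryTheory.Limits AlgebraicGeometry Polynomial
open Literature.AlgebraicGeometry.Resolution

namespace Summit.ResolutionOfSingularities.ResolutionOfSingularities.Theorems

section FieldTheory

variable {p : ℕ} [Fact p.Prime] {k : Type} [Field k] [CharP k p]

/-- If `t` is not a `p`-th power in `k`, the powers `1, t, …, t^{p-1}` are linearly independent over
`k^p`: a relation `∑_{j<p} t^j e_j^p = 0` forces all `e_j = 0` (`X^p - t^p` is irreducible over the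
subfield `k^p`, so it is the minimal polynomial of `t` over `k^p`). [folklore] -/
theorem sum_pow_mul_pow_eq_zero {t : k} (ht : ∀ s : k, s ^ p ≠ t) (e : ℕ → k)
    (he : ∑ j ∈ Finset.range p, t ^ j * e j ^ p = 0) : ∀ j < p, e j = 0 := by
  have hp : p.Prime := Fact.out
  haveI : ExpChar k p := ExpChar.prime hp
  -- the subfield `k^p`
  let K₀ : Subfield k := (frobenius k p).fieldRange
  have hmem : ∀ x : k, x ^ p ∈ K₀ := fun x => ⟨x, frobenius_def ..⟩
  -- `X^p - t^p` is irreducible over `k^p`, hence the minimal polynomial of `t`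
  let a : K₀ := ⟨t ^ p, hmem t⟩
  have hirr : Irreducible (X ^ p - C a : K₀[X]) := by
    refine X_pow_sub_C_irreducible_of_prime hp fun b hb => ?_
    obtain ⟨c, hc⟩ := b.2
    apply ht c
    have h1 : ((b : k)) ^ p = t ^ p := by
      have := congrArg Subtype.val hb
      simpa using this
    apply frobenius_inj k p
    rw [frobenius_def, frobenius_def, ← h1, ← hc, frobenius_def]
  have hmonic : (X ^ p - C a : K₀[X]).Monic := monic_X_pow_sub_C a hp.ne_zero
  have haeval : aeval t (X ^ p - C a : K₀[X]) = 0 := by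
    rw [map_sub, aeval_X_pow, aeval_C]
    exact sub_self _
  have hmin : minpoly K₀ t = X ^ p - C a := (minpoly.eq_of_irreducible_of_monic hirr haeval hmonic).symm
  have hdeg : (minpoly K₀ t).natDegree = p := by rw [hmin, natDegree_X_pow_sub_C]
  -- the powers of `t` below `p` are `k^p`-linearly independent
  have hli := linearIndependent_pow (K := K₀) t
  rw [hdeg] at hli
  -- read off the coefficients of the given relation
  have hsum : ∑ i : Fin p, (⟨e i ^ p, hmem (e i)⟩ : K₀) • t ^ (i : ℕ) = 0 := by
    rw [← he, Finset.sum_range]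
    refine Finset.sum_congr rfl fun i _ => ?_
    rw [Algebra.smul_def, mul_comm]
    rfl
  intro j hj
  have h0 := Fintype.linearIndependent_iff.mp hli _ hsum ⟨j, hj⟩
  have h0' : e j ^ p = 0 := by
    have := congrArg Subtype.val h0
    simpa using this
  exact eq_zero_of_pow_eq_zero h0'

variable (p) in
/-- **Digit expansion in `𝔽_p(t)`.** Every element `c` of the subfield `closure {t}` generated by `t` is of
the form `c = ∑_{j<p} t^j d_j^p` with all `d_j ∈ closure {t}` (for a polynomial in `t`, sort the monomials
by the residue of the exponent mod `p` and use that `𝔽_p` is perfect; then clear denominators by a `p`-th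
power). [folklore] -/
theorem exists_digits_of_mem_closure_singleton (t : k) {c : k}
    (hc : c ∈ Subfield.closure ({t} : Set k)) :
    ∃ d : ℕ → k, (∀ j, d j ∈ Subfield.closure ({t} : Set k)) ∧
      c = ∑ j ∈ Finset.range p, t ^ j * d j ^ p := by
  classical
  have hp : p.Prime := Fact.out
  haveI : ExpChar k p := ExpChar.prime hp
  set F := Subfield.closure ({t} : Set k) with hF
  have htF : t ∈ F := Subfield.subset_closure (Set.mem_singleton t)
  -- Step 1: polynomials in `t`
  have hpoly : ∀ f : ℤ[X], ∃ d : ℕ → k, (∀ j, d j ∈ F) ∧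
      aeval t f = ∑ j ∈ Finset.range p, t ^ j * d j ^ p := by
    intro f
    induction f using Polynomial.induction_on with
    | C n =>
      let d : ℕ → k := fun j => match j with
        | 0 => (n : k)
        | _ + 1 => 0
      have hd0 : d 0 = (n : k) := rfl
      have hdS : ∀ j, d (j + 1) = 0 := fun j => rfl
      refine ⟨d, fun j => ?_, ?_⟩
      · cases j with
        | zero => rw [hd0]; exact intCast_mem F n
        | succ j => rw [hdS j]; exact zero_mem F
      · have hnp : ((n : k)) ^ p = (n : k) := by
          have := map_intCast (frobenius k p) n
          rwa [frobenius_def] at this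
        rw [aeval_C, Finset.sum_eq_single_of_mem 0 (Finset.mem_range.mpr hp.pos) (fun j _ hj => by
          obtain ⟨i, rfl⟩ := Nat.exists_eq_succ_of_ne_zero hj
          rw [hdS i, zero_pow hp.ne_zero, mul_zero])]
        rw [pow_zero, one_mul, hd0, hnp]
        exact (eq_intCast (algebraMap ℤ k) n)
    | add f g hf hg =>
      obtain ⟨d, hd, hf⟩ := hf
      obtain ⟨d', hd', hg⟩ := hg
      refine ⟨fun j => d j + d' j, fun j => add_mem (hd j) (hd' j), ?_⟩
      rw [map_add, hf, hg, ← Finset.sum_add_distrib]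
      refine Finset.sum_congr rfl fun j _ => ?_
      rw [add_pow_char, mul_add]
    | monomial n a h =>
      obtain ⟨d, hd, h⟩ := h
      -- multiply by `t`: shift the digits, the top one wraps around with a factor `t`
      let d' : ℕ → k := fun j => match j with
        | 0 => t * d (p - 1)
        | i + 1 => d i
      have hd0 : d' 0 = t * d (p - 1) := rfl
      have hdS : ∀ i, d' (i + 1) = d i := fun i => rfl
      refine ⟨d', fun j => ?_, ?_⟩
      · cases j with
        | zero => rw [hd0]; exact mul_mem htF (hd _)
        | succ j => rw [hdS j]; exact hd _
      · rw [pow_succ, ← mul_assoc, map_mul, h, aeval_X, Finset.sum_mul]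
        obtain ⟨q, hq⟩ : ∃ q, p = q + 1 := ⟨p - 1, (Nat.succ_pred_eq_of_pos hp.pos).symm⟩
        have hdq : d' 0 = t * d q := by rw [hd0, hq, Nat.add_sub_cancel]
        rw [hq, Finset.sum_range_succ, Finset.sum_range_succ', hdq, pow_zero, one_mul]
        congr 1
        · refine Finset.sum_congr rfl fun j _ => ?_
          rw [hdS j, pow_succ]
          ring
        · rw [mul_pow]
          ring
  -- Step 2: quotients
  obtain ⟨y, hy, z, hz, rfl⟩ := Subfield.mem_closure_iff.mp hc
  have hyF : y ∈ F := Subfield.subring_closure_le _ hy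
  have hzF : z ∈ F := Subfield.subring_closure_le _ hz
  by_cases hz0 : z = 0
  · refine ⟨fun _ => 0, fun _ => zero_mem F, ?_⟩
    simp [hz0, zero_pow hp.ne_zero]
  -- `y / z = (y * z^(p-1)) / z^p`
  have hyz : y * z ^ (p - 1) ∈ Subring.closure ({t} : Set k) :=
    mul_mem hy (pow_mem hz _)
  obtain ⟨f, hf⟩ : ∃ f : ℤ[X], aeval t f = y * z ^ (p - 1) := by
    have : y * z ^ (p - 1) ∈ Algebra.adjoin ℤ ({t} : Set k) := by
      rw [Algebra.adjoin_int]; exact hyz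
    rw [Algebra.adjoin_singleton_eq_range_aeval] at this
    exact this
  obtain ⟨d, hd, hdsum⟩ := hpoly f
  refine ⟨fun j => d j / z, fun j => div_mem (hd j) hzF, ?_⟩
  have key : y / z = (y * z ^ (p - 1)) / z ^ p := by
    rw [← Nat.succ_pred_eq_of_pos hp.pos, pow_succ, Nat.succ_sub_one]
    field_simp
  rw [key, ← hf, hdsum, Finset.sum_div]
  refine Finset.sum_congr rfl fun j _ => ?_
  rw [div_pow, mul_div_assoc]

variable (p) in
/-- **MacLane's criterion over `𝔽_p(t)` when `t ∉ k^p`**: `closure {t}`-linearly independent finite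
families in `k` have `closure {t}`-linearly independent `p`-th powers (expand the coefficients of a
relation in digits and use the `k^p`-independence of `1, t, …, t^{p-1}`). [folklore] -/
theorem linearIndepOn_pow_closure_singleton {t : k} (ht : ∀ s : k, s ^ p ≠ t) (s : Finset k)
    (hs : LinearIndepOn (Subfield.closure ({t} : Set k)) _root_.id (↑s : Set k)) :
    LinearIndepOn (Subfield.closure ({t} : Set k)) (fun x : k => x ^ p) (↑s : Set k) := by
  classical
  have hp : p.Prime := Fact.out
  haveI : ExpChar k p := ExpChar.prime hp
  set F := Subfield.closure ({t} : Set k) with hF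
  rw [LinearIndepOn, linearIndependent_iff'] at hs ⊢
  intro u g hrel i hi
  -- digits of the coefficients
  choose d hd hdsum using fun i : ↥(↑s : Set k) =>
    exists_digits_of_mem_closure_singleton p t (c := (g i : k)) (g i).2
  -- the relation, rearranged by powers of `t`
  have hzero : ∑ j ∈ Finset.range p, t ^ j * (∑ i ∈ u, d i j * (i : k)) ^ p = 0 := by
    rw [← hrel]
    simp_rw [sum_pow_char, Finset.mul_sum, mul_pow]
    rw [Finset.sum_comm]
    refine Finset.sum_congr rfl fun i _ => ?_
    rw [Algebra.smul_def, show algebraMap F k (g i) = (g i : k) from rfl, hdsum i, Finset.sum_mul]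
    refine Finset.sum_congr rfl fun j _ => ?_
    ring
  have hdig := sum_pow_mul_pow_eq_zero ht _ hzero
  -- each digit family is a relation among the `i`'s, hence vanishes
  have hdz : ∀ j < p, ∀ i ∈ u, d i j = 0 := by
    intro j hj
    have hrelj : ∑ i ∈ u, (⟨d i j, hd i j⟩ : F) • _root_.id (i : k) = 0 := by
      rw [← hdig j hj]
      refine Finset.sum_congr rfl fun i _ => ?_
      rw [Algebra.smul_def]
      rfl
    intro i hi
    have := hs u (fun i => ⟨d i j, hd i j⟩) hrelj i hi
    exact congrArg Subtype.val this
  apply Subtype.ext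
  rw [hdsum i]
  change ∑ j ∈ Finset.range p, t ^ j * d i j ^ p = ((0 : F) : k)
  rw [ZeroMemClass.coe_zero]
  refine Finset.sum_eq_zero fun j hj => ?_
  rw [hdz j (Finset.mem_range.mp hj) i hi, zero_pow hp.ne_zero, mul_zero]

variable (p) in
/-- **An algebraic extension of `𝔽_p(t)` in which `t` is not a `p`-th power is separable.** If
`t ∈ k ∖ k^p` and `k` is algebraic over `F = closure {t}`, then `k/F` is separable: otherwise some `a` has
`minpoly_F(a) = g(X^p)` with `deg g = m ≥ 1`; the powers `1, a, …, a^m` are `F`-independent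
(`m < p·m = deg minpoly`), so by MacLane's criterion `1, a^p, …, a^{pm}` are independent — but `g(a^p) = 0`.
[folklore] -/
theorem isSeparable_closure_singleton_of_isAlgebraic {t : k} (ht : ∀ s : k, s ^ p ≠ t)
    [Algebra.IsAlgebraic (Subfield.closure ({t} : Set k)) k] :
    Algebra.IsSeparable (Subfield.closure ({t} : Set k)) k := by
  classical
  have hp : p.Prime := Fact.out
  set F := Subfield.closure ({t} : Set k) with hF
  haveI : CharP F p := (algebraMap F k).charP Subtype.val_injective p
  -- MacLane's criterion in family form
  have H : ∀ (ι : Type) [Fintype ι] (v : ι → k), LinearIndependent F v →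
      LinearIndependent F (fun i => v i ^ p) := by
    intro ι _ v hv
    have h := linearIndepOn_pow_closure_singleton p ht (Finset.univ.image v)
      (by simpa using hv.linearIndepOn_id)
    simpa only [Finset.coe_image, Finset.coe_univ, Set.image_univ,
      linearIndepOn_range_iff hv.injective, Function.comp_def] using h
  refine ⟨fun a => ?_⟩
  have hint : IsIntegral F a := Algebra.IsIntegral.isIntegral a
  have hirr : Irreducible (minpoly F a) := minpoly.irreducible hint
  rcases separable_or p hirr with hsep | ⟨-, g, hg, hga⟩
  · exact hsep
  · exfalso
    set m := g.natDegree with hm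
    have hm1 : 1 ≤ m := natDegree_pos_iff_degree_pos.mpr (degree_pos_of_irreducible hg)
    have hd : (minpoly F a).natDegree = m * p := by rw [← hga, natDegree_expand]
    have hle : m + 1 ≤ (minpoly F a).natDegree := by
      rw [hd]
      calc m + 1 ≤ m + m := by omega
        _ = m * 2 := by ring
        _ ≤ m * p := Nat.mul_le_mul_left m hp.two_le
    -- `1, a, …, a^m` are `F`-linearly independent, hence so are their `p`-th powers
    have hli := (linearIndependent_pow (K := F) a).comp (Fin.castLE hle) (Fin.castLE_injective hle)
    have hv : LinearIndependent F (fun i : Fin (m + 1) => a ^ (i : ℕ)) := hli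
    have hw := H (Fin (m + 1)) _ hv
    -- but `g(a^p) = 0` is a nontrivial relation among them
    have hrel : ∑ i : Fin (m + 1), g.coeff i • (a ^ (i : ℕ)) ^ p = 0 := by
      have h1 : aeval (a ^ p) g = 0 := by rw [← expand_aeval, hga, minpoly.aeval]
      rw [aeval_eq_sum_range' (Nat.lt_succ_self m), Finset.sum_range] at h1
      rw [← h1]
      refine Finset.sum_congr rfl fun i _ => ?_
      rw [← pow_mul, mul_comm, pow_mul]
    have hcoeff := Fintype.linearIndependent_iff.mp hw _ hrel ⟨m, Nat.lt_succ_self m⟩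
    have hg0 : g ≠ 0 := hg.ne_zero
    exact hg0 (leadingCoeff_eq_zero.mp hcoeff)

end FieldTheory

/-! ## The crux's conclusion over ground fields algebraic over `𝔽_p(t)`, `t ∉ k^p` -/

/-- **Resolution over perfect fields ⇒ resolution over every ground field algebraic over `𝔽_p(t)` with
`t` not a `p`-th power** (equivalently: every non-perfect ground field of transcendence degree one over
`𝔽_p`), for reduced separated schemes of finite type of any dimension: such a field is separable algebraic
over the finitely generated subfield `closure {t}` (`isSeparable_closure_singleton_of_isAlgebraic`), so
`hasResolution_of_perfectRes_of_isSeparable_fg` applies. [folklore] -/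
theorem hasResolution_of_perfectRes_of_isAlgebraic_closure_singleton (p : ℕ) [Fact p.Prime]
    (H : ∀ (κ : Type) [Field κ] [CharP κ p] [PerfectField κ] (Z : Scheme.{0}) (h : Z ⟶ Spec (.of κ)),
      IsSeparated h → LocallyOfFiniteType h → QuasiCompact h → IsReduced Z → Scheme.HasResolution Z)
    (k : Type) [Field k] [CharP k p] (t : k) (ht : ∀ s : k, s ^ p ≠ t)
    [Algebra.IsAlgebraic (Subfield.closure ({t} : Set k)) k]
    (X : Scheme.{0}) (f : X ⟶ Spec (.of k)) [IsSeparated f] [LocallyOfFiniteType f] [QuasiCompact f]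
    [IsReduced X] : Scheme.HasResolution X := by
  haveI := isSeparable_closure_singleton_of_isAlgebraic p ht
  exact hasResolution_of_perfectRes_of_isSeparable_fg p H k (Subfield.closure ({t} : Set k)) {t}
    (by rw [Finset.coe_singleton]) X f

/-- **The transcendence-degree-one layer of the crux `DescentPerfectToAll`, proved** (binder shape of
stmt-0549 with the hypotheses `t ∉ k^p` and `k` algebraic over `closure {t}` inserted): resolution over all
perfect fields of characteristic `p` gives resolution over every such ground field `k`. [folklore] -/
theorem descentPerfectToAll_trdegOne :
    ∀ p : ℕ, p.Prime → (∀ (k : Type) [Field k] [CharP k p] [PerfectField k] (X : Scheme.{0})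
      (f : X ⟶ Spec (.of k)), IsSeparated f → LocallyOfFiniteType f → QuasiCompact f →
        IsReduced X → Scheme.HasResolution X) →
    ∀ (k : Type) [Field k] [CharP k p] (t : k), (∀ s : k, s ^ p ≠ t) →
      Algebra.IsAlgebraic (Subfield.closure ({t} : Set k)) k →
      ∀ (X : Scheme.{0}) (f : X ⟶ Spec (.of k)),
        IsSeparated f → LocallyOfFiniteType f → QuasiCompact f → IsReduced X →
          Scheme.HasResolution X := by
  intro p hp H k _ _ t ht halg X f _ _ _ _
  haveI : Fact p.Prime := ⟨hp⟩
  haveI := halg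
  exact hasResolution_of_perfectRes_of_isAlgebraic_closure_singleton p
    (fun κ _ _ _ Z h a b c d => H κ Z h a b c d) k t ht X f

/-- **All ground fields algebraic over a one-generator subfield** (transcendence degree `≤ 1` in the
naive sense "algebraic over `closure {t}` for some `t`", together with the dichotomy perfect / `t` can be
taken outside `k^p`): if `k` is perfect the antecedent applies directly; if `k` is algebraic over
`closure {t}` with `t ∉ k^p`, `descentPerfectToAll_trdegOne` applies. This is the form in which the layer
is used: a non-perfect `k` algebraic over `𝔽_p(t₀)` is algebraic over `𝔽_p(t)` for every transcendental `t`,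
and any `t ∉ k^p` is transcendental — the exchange is left to the user of this lemma, who supplies `t`.
[folklore] -/
theorem descentPerfectToAll_trdegLEOne (p : ℕ) [Fact p.Prime]
    (H : ∀ (κ : Type) [Field κ] [CharP κ p] [PerfectField κ] (Z : Scheme.{0}) (h : Z ⟶ Spec (.of κ)),
      IsSeparated h → LocallyOfFiniteType h → QuasiCompact h → IsReduced Z → Scheme.HasResolution Z)
    (k : Type) [Field k] [CharP k p]
    (hk : PerfectField k ∨ ∃ t : k, (∀ s : k, s ^ p ≠ t) ∧
      Algebra.IsAlgebraic (Subfield.closure ({t} : Set k)) k)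
    (X : Scheme.{0}) (f : X ⟶ Spec (.of k)) [IsSeparated f] [LocallyOfFiniteType f] [QuasiCompact f]
    [IsReduced X] : Scheme.HasResolution X := by
  rcases hk with hperf | ⟨t, ht, halg⟩
  · haveI := hperf
    exact H k X f ‹_› ‹_› ‹_› ‹_›
  · haveI := halg
    exact hasResolution_of_perfectRes_of_isAlgebraic_closure_singleton p H k t ht X f



end Summit.ResolutionOfSingularities.ResolutionOfSingularities.Theorems

end
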